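import Mathlib
import Summits.PneNP.PneNP.Theorems.ConvexRankGatesConvexGateBlindAffinePencil

/-!
# PneNP / ConvexRankGates — `ConvexGateBlind`: arrow pencils — second-order-cone constraints as affine `(d+1) × (d+1)` pencils

Helpers (`--supports stmt-PneNP-10680`), COLUMN-SPACE line (prover seat 2, session 26), PSD side. The `2 × 2` toolkit of
`…AffinePencilSoc.lean` (one second-order-cone constraint in `ℝ × ℝ²`) in every dimension: the ARROW MATRIX

    `arrow a b = [[a, bᵀ], [b, a·I_d]]`      (`a : ℝ`, `b : Fin d → ℝ`, indexed by `Fin (d+1)`, apex `0`)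

has quadratic form `a·y₀² + 2y₀⟨b, y'⟩ + a·‖y'‖²` (`dotProduct_arrow_mulVec`), is positive semidefinite when `0 ≤ a` and
`Σ bᵢ² ≤ a²` (`arrow_posSemidef`, Cauchy–Schwarz) and is NOT when `a < 0` or `a² < Σ bᵢ²` (`arrow_not_posSemidef_of_neg`,
`arrow_not_posSemidef_of_sq_lt`, explicit test vectors) — i.e. `arrow a b ⪰ 0 ⟺ (a; b)` lies in the Lorentz cone. `arrow` is
additive (`arrow_add`, `arrow_sub`, `arrow_neg`, `arrow_sum`), so an affine SOC map `u ↦ (a₀ − Σ_{e∈u} α_e ; b₀ − Σ_{e∈u} β_e)`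
IS the affine pencil `H(x) = arrow a₀ b₀ − Σ_e x_e · arrow α_e β_e` of the tree's dual-affine PSD class (`arrow_pencil_apply`,
`arrow_pencil_posSemidef`, `arrow_pencil_not_posSemidef`): Lorentz-cone constructions of any dimension `d` are valid
`(d+1) × (d+1)` pencils, the form in which the exclusion-number constructions of session 26 (memo ANALYSIS-seat2-s26 §2) are
stated. [folklore]
-/

set_option linter.dupNamespace false

namespace Summit.PneNP.PneNP.Theorems

open Finset Real Matrix Literature.Computability.Complexity
open Summit.PneNP.PneNP.Cruxes.ConvexGateBlind.StrictRankConicCover (Edge cdist)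

noncomputable section

variable {d : ℕ}

/-! ## The arrow matrix and its quadratic form -/

/-- The arrow matrix `[[a, bᵀ], [b, a·I_d]]` on `Fin (d+1)` (apex index `0`). [folklore] -/
def arrow (a : ℝ) (b : Fin d → ℝ) : Matrix (Fin (d + 1)) (Fin (d + 1)) ℝ :=
  Matrix.of fun i j =>
    Fin.cases (Fin.cases a (fun j' => b j') j) (fun i' => Fin.cases (b i') (fun j' => if i' = j' then a else 0) j) i

/-- Apex entry. [folklore] -/
@[simp] theorem arrow_zero_zero (a : ℝ) (b : Fin d → ℝ) : arrow a b 0 0 = a := by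
  simp [arrow]

/-- First row. [folklore] -/
@[simp] theorem arrow_zero_succ (a : ℝ) (b : Fin d → ℝ) (j : Fin d) : arrow a b 0 j.succ = b j := by
  simp [arrow]

/-- First column. [folklore] -/
@[simp] theorem arrow_succ_zero (a : ℝ) (b : Fin d → ℝ) (i : Fin d) : arrow a b i.succ 0 = b i := by
  simp [arrow]

/-- Scalar block `a·I_d`. [folklore] -/
@[simp] theorem arrow_succ_succ (a : ℝ) (b : Fin d → ℝ) (i j : Fin d) :
    arrow a b i.succ j.succ = if i = j then a else 0 := by
  simp [arrow]

/-- The arrow matrix is symmetric. [folklore] -/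
theorem arrow_isHermitian (a : ℝ) (b : Fin d → ℝ) : (arrow a b).IsHermitian := by
  refine Matrix.IsHermitian.ext fun i j => ?_
  simp only [star_trivial]
  induction i using Fin.cases with
  | zero =>
    induction j using Fin.cases with
    | zero => simp
    | succ j' => simp
  | succ i' =>
    induction j using Fin.cases with
    | zero => simp
    | succ j' =>
      simp only [arrow_succ_succ]
      by_cases h : i' = j'
      · subst h; simp
      · simp [h, Ne.symm h]

/-- The quadratic form of the arrow matrix: `a·y₀² + 2y₀·Σ bᵢ yᵢ₊₁ + a·Σ yᵢ₊₁²`. [folklore] -/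
theorem dotProduct_arrow_mulVec (a : ℝ) (b : Fin d → ℝ) (y : Fin (d + 1) → ℝ) :
    y ⬝ᵥ (arrow a b *ᵥ y) =
      a * y 0 ^ 2 + 2 * y 0 * (∑ i, b i * y i.succ) + a * ∑ i : Fin d, y i.succ ^ 2 := by
  have hrow0 : (arrow a b *ᵥ y) 0 = a * y 0 + ∑ i, b i * y i.succ := by
    simp only [Matrix.mulVec, dotProduct, Fin.sum_univ_succ, arrow_zero_zero, arrow_zero_succ]
  have hrowS : ∀ i : Fin d, (arrow a b *ᵥ y) i.succ = b i * y 0 + a * y i.succ := by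
    intro i
    simp only [Matrix.mulVec, dotProduct, Fin.sum_univ_succ, arrow_succ_zero, arrow_succ_succ]
    congr 1
    rw [Finset.sum_eq_single i]
    · simp
    · intro j _ hji
      simp [Ne.symm hji]
    · intro h; exact absurd (Finset.mem_univ i) h
  rw [dotProduct, Fin.sum_univ_succ, hrow0]
  simp only [hrowS]
  have h1 : ∑ i : Fin d, y i.succ * (b i * y 0 + a * y i.succ) =
      y 0 * ∑ i, b i * y i.succ + a * ∑ i : Fin d, y i.succ ^ 2 := by
    rw [Finset.mul_sum, Finset.mul_sum, ← Finset.sum_add_distrib]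
    refine Finset.sum_congr rfl fun i _ => ?_
    ring
  rw [h1]
  ring

/-! ## Lorentz cone ⟺ PSD -/

/-- **SOC ⟹ PSD.** If `0 ≤ a` and `Σ bᵢ² ≤ a²` then `arrow a b ⪰ 0` (Cauchy–Schwarz: `(Σ bᵢyᵢ₊₁)² ≤ a²·Σ yᵢ₊₁²`, then
`a·(a y₀² + 2y₀c + a s) = (a y₀ + c)² + (a²s − c²)`). [folklore] -/
theorem arrow_posSemidef {a : ℝ} {b : Fin d → ℝ} (ha : 0 ≤ a) (hb : ∑ i, b i ^ 2 ≤ a ^ 2) :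
    (arrow a b).PosSemidef := by
  refine PosSemidef.of_dotProduct_mulVec_nonneg (arrow_isHermitian a b) fun y => ?_
  rw [star_trivial, dotProduct_arrow_mulVec]
  set c : ℝ := ∑ i, b i * y i.succ with hc
  set s : ℝ := ∑ i : Fin d, y i.succ ^ 2 with hs
  have hs0 : 0 ≤ s := Finset.sum_nonneg fun i _ => sq_nonneg _
  have hcs : c ^ 2 ≤ (∑ i, b i ^ 2) * s := by
    rw [hc, hs]; exact Finset.sum_mul_sq_le_sq_mul_sq _ _ _
  have hcs' : c ^ 2 ≤ a ^ 2 * s := hcs.trans (mul_le_mul_of_nonneg_right hb hs0)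
  rcases ha.lt_or_eq with ha' | ha'
  · -- `a > 0`
    have key : a * (a * y 0 ^ 2 + 2 * y 0 * c + a * s) = (a * y 0 + c) ^ 2 + (a ^ 2 * s - c ^ 2) := by ring
    have hnn : 0 ≤ a * (a * y 0 ^ 2 + 2 * y 0 * c + a * s) := by
      rw [key]; nlinarith [sq_nonneg (a * y 0 + c)]
    exact le_of_mul_le_mul_left (by linarith [hnn] : a * 0 ≤ a * (a * y 0 ^ 2 + 2 * y 0 * c + a * s)) ha'
  · -- `a = 0`: then `b = 0` in effect and the form vanishes
    subst ha'
    have hb0 : ∑ i, b i ^ 2 ≤ 0 := by simpa using hb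
    have hc0 : c ^ 2 ≤ 0 := by nlinarith
    have hc00 : c = 0 := by nlinarith [sq_nonneg c]
    rw [hc00]; simp

/-- **Negative budget ⟹ not PSD** (test vector `e₀`). [folklore] -/
theorem arrow_not_posSemidef_of_neg {a : ℝ} (b : Fin d → ℝ) (ha : a < 0) : ¬ (arrow a b).PosSemidef := by
  intro h
  have h0 := h.dotProduct_mulVec_nonneg (Pi.single 0 1)
  rw [star_trivial, dotProduct_arrow_mulVec] at h0
  simp at h0
  linarith

/-- **Outside the cone ⟹ not PSD.** If `0 ≤ a` and `a² < Σ bᵢ²` then `arrow a b` is not PSD (test vector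
`(Σ bᵢ², −a·b)` for `a > 0`, `(1, −b)` for `a = 0`). [folklore] -/
theorem arrow_not_posSemidef_of_sq_lt {a : ℝ} {b : Fin d → ℝ} (ha : 0 ≤ a) (hb : a ^ 2 < ∑ i, b i ^ 2) :
    ¬ (arrow a b).PosSemidef := by
  intro h
  set B : ℝ := ∑ i, b i ^ 2 with hB
  have hB0 : 0 < B := lt_of_le_of_lt (sq_nonneg a) hb
  rcases ha.lt_or_eq with ha' | ha'
  · -- test vector `(B, −a b)`
    have h0 := h.dotProduct_mulVec_nonneg (Fin.cases B (fun i => -(a * b i)))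
    rw [star_trivial, dotProduct_arrow_mulVec] at h0
    simp only [Fin.cases_zero, Fin.cases_succ] at h0
    have h1 : ∑ i : Fin d, b i * -(a * b i) = -(a * B) := by
      rw [hB, Finset.mul_sum, ← Finset.sum_neg_distrib]
      refine Finset.sum_congr rfl fun i _ => ?_; ring
    have h2 : ∑ i : Fin d, (-(a * b i)) ^ 2 = a ^ 2 * B := by
      rw [hB, Finset.mul_sum]
      refine Finset.sum_congr rfl fun i _ => ?_; ring
    rw [h1, h2] at h0
    have : a * B ^ 2 + 2 * B * -(a * B) + a * (a ^ 2 * B) = a * B * (a ^ 2 - B) := by ring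
    rw [this] at h0
    have hneg : a * B * (a ^ 2 - B) < 0 := mul_neg_of_pos_of_neg (mul_pos ha' hB0) (by linarith)
    linarith
  · -- `a = 0`: test vector `(1, −b)`
    subst ha'
    have h0 := h.dotProduct_mulVec_nonneg (Fin.cases 1 (fun i => -b i))
    rw [star_trivial, dotProduct_arrow_mulVec] at h0
    simp only [Fin.cases_zero, Fin.cases_succ] at h0
    have h1 : ∑ i : Fin d, b i * -b i = -B := by
      rw [hB, ← Finset.sum_neg_distrib]
      refine Finset.sum_congr rfl fun i _ => ?_; ring
    rw [h1] at h0
    simp at h0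
    linarith

/-! ## Linearity: affine SOC maps are affine arrow pencils -/

/-- `arrow` is additive. [folklore] -/
theorem arrow_add (a a' : ℝ) (b b' : Fin d → ℝ) : arrow (a + a') (b + b') = arrow a b + arrow a' b' := by
  ext i j
  induction i using Fin.cases with
  | zero =>
    induction j using Fin.cases with
    | zero => simp
    | succ j' => simp
  | succ i' =>
    induction j using Fin.cases with
    | zero => simp
    | succ j' => by_cases h : i' = j' <;> simp [h]

/-- `arrow 0 0 = 0`. [folklore] -/
theorem arrow_zero : arrow (0 : ℝ) (0 : Fin d → ℝ) = 0 := by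
  ext i j
  induction i using Fin.cases with
  | zero =>
    induction j using Fin.cases with
    | zero => simp
    | succ j' => simp
  | succ i' =>
    induction j using Fin.cases with
    | zero => simp
    | succ j' => by_cases h : i' = j' <;> simp [h]

/-- `arrow` commutes with negation. [folklore] -/
theorem arrow_neg (a : ℝ) (b : Fin d → ℝ) : arrow (-a) (-b) = -arrow a b := by
  have h := arrow_add a (-a) b (-b)
  rw [add_neg_cancel, add_neg_cancel, arrow_zero] at h
  exact (neg_eq_of_add_eq_zero_right h.symm).symm

/-- `arrow` commutes with subtraction. [folklore] -/
theorem arrow_sub (a a' : ℝ) (b b' : Fin d → ℝ) : arrow (a - a') (b - b') = arrow a b - arrow a' b' := by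
  rw [sub_eq_add_neg, sub_eq_add_neg, arrow_add, arrow_neg, ← sub_eq_add_neg]

/-- `arrow` commutes with finite sums. [folklore] -/
theorem arrow_sum {ι : Type*} (s : Finset ι) (a : ι → ℝ) (b : ι → Fin d → ℝ) :
    arrow (∑ i ∈ s, a i) (∑ i ∈ s, b i) = ∑ i ∈ s, arrow (a i) (b i) := by
  classical
  induction s using Finset.induction_on with
  | empty => simp [arrow_zero]
  | insert x s hx ih => rw [Finset.sum_insert hx, Finset.sum_insert hx, Finset.sum_insert hx, arrow_add, ih]

/-- **An affine SOC map is an affine arrow pencil**: with `H₀ = arrow a₀ b₀` and `H_e = arrow (α e) (β e)`,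
`H₀ − Σ_e [u e]·H_e = arrow (a₀ − Σ_{e : u e} α e) (b₀ − Σ_{e : u e} β e)`. [folklore] -/
theorem arrow_pencil_apply {m : ℕ} (a₀ : ℝ) (b₀ : Fin d → ℝ) (α : Edge m → ℝ) (β : Edge m → Fin d → ℝ)
    (u : Edge m → Bool) :
    (arrow a₀ b₀ - ∑ e, if u e = true then arrow (α e) (β e) else 0) =
      arrow (a₀ - ∑ e, if u e = true then α e else 0) (b₀ - ∑ e, if u e = true then β e else 0) := by
  classical
  rw [arrow_sub, arrow_sum]
  congr 1
  refine Finset.sum_congr rfl fun e _ => ?_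
  split_ifs
  · rfl
  · rw [arrow_zero]

/-- **Valid direction of the dictionary**: if at the graph `u` the SOC data satisfy `0 ≤ a(u)` and `Σᵢ b(u)ᵢ² ≤ a(u)²`
then the arrow pencil is PSD at `u`. [folklore] -/
theorem arrow_pencil_posSemidef {m : ℕ} (a₀ : ℝ) (b₀ : Fin d → ℝ) (α : Edge m → ℝ) (β : Edge m → Fin d → ℝ)
    (u : Edge m → Bool) (ha : 0 ≤ a₀ - ∑ e, if u e = true then α e else 0)
    (hb : ∑ i, (b₀ - ∑ e, if u e = true then β e else 0) i ^ 2 ≤ (a₀ - ∑ e, if u e = true then α e else 0) ^ 2) :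
    (arrow a₀ b₀ - ∑ e, if u e = true then arrow (α e) (β e) else 0).PosSemidef := by
  rw [arrow_pencil_apply]
  exact arrow_posSemidef ha hb

/-- **Excluding direction of the dictionary**: if at `u` the SOC data are outside the cone (`a(u) < 0`, or
`a(u)² < Σᵢ b(u)ᵢ²`) then the arrow pencil is not PSD at `u`. [folklore] -/
theorem arrow_pencil_not_posSemidef {m : ℕ} (a₀ : ℝ) (b₀ : Fin d → ℝ) (α : Edge m → ℝ) (β : Edge m → Fin d → ℝ)
    (u : Edge m → Bool)
    (h : (a₀ - ∑ e, if u e = true then α e else 0) < 0 ∨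
      (a₀ - ∑ e, if u e = true then α e else 0) ^ 2 < ∑ i, (b₀ - ∑ e, if u e = true then β e else 0) i ^ 2) :
    ¬ (arrow a₀ b₀ - ∑ e, if u e = true then arrow (α e) (β e) else 0).PosSemidef := by
  rw [arrow_pencil_apply]
  rcases h with h | h
  · exact arrow_not_posSemidef_of_neg _ h
  · by_cases ha : 0 ≤ a₀ - ∑ e, if u e = true then α e else 0
    · exact arrow_not_posSemidef_of_sq_lt ha h
    · exact arrow_not_posSemidef_of_neg _ (lt_of_not_ge ha)

/-- **The arrow dictionary** (registered form): `0 ≤ a`, `Σ bᵢ² ≤ a²` ⟹ `arrow a b ⪰ 0`, and `a² < Σ bᵢ²` (with `0 ≤ a`)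
⟹ `arrow a b ⋡ 0` — second-order-cone constraints of every dimension are affine pencils of the dual-affine PSD class.
[folklore] -/
theorem arrow_posSemidef_iff_soc : ∀ {d : ℕ} (a : ℝ) (b : Fin d → ℝ), 0 ≤ a → ((arrow a b).PosSemidef ↔ ∑ i, b i ^ 2 ≤ a ^ 2) :=
  fun _ _ ha => ⟨fun h => le_of_not_gt fun hlt => arrow_not_posSemidef_of_sq_lt ha hlt h, fun hb => arrow_posSemidef ha hb⟩

end

end Summit.PneNP.PneNP.Theorems
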